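import Summits.AtomisticToContinuum.HydrodynamicLimit.Theorems.AntiMazurCoboundariesKineticFluxLdDecayObjects
import Summits.AtomisticToContinuum.HydrodynamicLimit.Theorems.JParityClosureOddContactSymmetryGibbsInvariance
import Literature.MathematicalPhysics.KineticTheory.HardSphereWindowPressureStatic
import Literature.Analysis.Approximation.LipschitzApproximationCompact
import HarnessLib

/-!
# Stub S2 `stub_lipschitzRegularisation` of the crux line `dynkin-azuma-collision-innovations`
# (crux `KineticFluxLdDecay`, stmt-AtomisticToContinuum-10967)

Helper file (`--supports stmt-AtomisticToContinuum-10967`) closing the registered stub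
`stub_lipschitzRegularisation` (S2) of the skeleton
`Cruxes/KineticFluxLdDecay/Lines/dynkin-azuma-collision-innovations.lean`, over the objects module
`AntiMazurCoboundariesKineticFluxLdDecayObjects` (`Flow`, `Phase`, `gibbs`, `window`, `sv`, `obsA`).

**Statement.** The crux's test function `φ : 𝕋³ → ℝ` is merely continuous (`|φ| ≤ 1`); the line needs a
`D`-Lipschitz `φ'`.  S2 says the replacement is free at the large-deviation level: for every `η > 0`
there is a continuous `D`-Lipschitz `φ'`, `|φ'| ≤ 1`, `|φ - φ'| ≤ η`, such that for all real `p`, all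
windows `τ > 0`, all `N` and all hard-sphere flows `Φ`,
`∫ exp(p (A_φ - A_φ')) dG_N ≤ exp((N+1) · (|p|ηb)² e^{|p|ηb} / 2)`,
`A_ψ(z) = h⁻¹∫₀ʰ ∑ᵢ ψ(xᵢ(s)) g(wᵢ(s)) ds` the crux's window functional (`obsA`), `G_N` the homogeneous
Gibbs law (`gibbs`), `g` continuous, `|g| ≤ b`, `∫ g dγ = 0`.

**Proof.** (1) `φ'` by the McShane / Pasch–Hausdorff envelope on the compact torus
(`Literature.Analysis.Approximation.exists_lipschitz_approx_of_continuous`).  (2) On the good set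
`p(A_φ - A_φ') = h⁻¹∫₀ʰ ∑ᵢ q(Φ_s z i) ds` with the ONE-BODY `q(x, v) = p(φ - φ')(x) g(w)` (linearity of
the interval integral; orbits of good points are interval integrable, `mul_obsA_sub_obsA_eq`), and the
good set is `G_N`-conull.  (3) The window pressure of a one-body observable under the flow-INVARIANT
(`measurePreserving_flow_localGibbsLaw_const`) homogeneous Gibbs law is at most `(N+1) log C`, `C` a
uniform bound of the one-site Gaussian exponential moment — Jensen in time, Tonelli, stationarity, and
the Gaussian product structure of `G_N` given the positions
(`Literature.MathematicalPhysics.KineticTheory.lintegral_exp_windowAvg_sum_localGibbsLaw_const_le`).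
(4) One site: `w = (v - u₀)/√θ` is standard Gaussian under `N(u₀, θ id)` and `t ↦ t g(w)`,
`|t| ≤ |p|η`, is sub-Gaussian with parameter `b²` (Hoeffding), so
`C = exp((|p|ηb)²/2) ≤ exp((|p|ηb)² e^{|p|ηb}/2)`.

References: C. Kipnis, C. Landim, *Scaling Limits of Interacting Particle Systems* (1999), App. 1
§5–6; H. Spohn, *Large Scale Dynamics of Interacting Particles* (1991), Part I §2.3; W. Hoeffding
(1963), Lemma 1; E. J. McShane, Bull. AMS 40 (1934).
-/

noncomputable section

open MeasureTheory ProbabilityTheory Set Filter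
open scoped ENNReal BigOperators
open Literature.Analysis.FluidPDE Literature.MathematicalPhysics.KineticTheory

namespace Summit.AtomisticToContinuum.HydrodynamicLimit.Theorems.DynkinAzuma

/-- **The difference of the crux functionals for two test functions is the window average of a
one-body observable** (pathwise, on the good set): for continuous `φ, φ', g` and `z ∈ Φ.good`,
`p (A_φ(z) - A_φ'(z)) = h⁻¹ ∫₀ʰ ∑ᵢ p (φ - φ')(xᵢ(s)) g(wᵢ(s)) ds` — both integrands are interval
integrable along the good orbit (`HardSphereFlow.intervalIntegrable_comp_flow_of_continuous`), so the
interval integral is linear. [folklore] -/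
theorem mul_obsA_sub_obsA_eq (θ : ℝ) (u₀ : V3) {φ φ' : T3 → ℝ} {g : V3 → ℝ} (hφ : Continuous φ)
    (hφ' : Continuous φ') (hg : Continuous g) (τ p : ℝ) {σ : ℝ} {N : ℕ} (Φ : Flow σ N) {z : Phase N}
    (hz : z ∈ Φ.good) :
    p * (obsA θ u₀ φ g τ Φ z - obsA θ u₀ φ' g τ Φ z) =
      (window τ N)⁻¹ * ∫ s in (0 : ℝ)..window τ N,
        ∑ i, p * ((φ (Φ.flow s z i).1 - φ' (Φ.flow s z i).1) * g (sv θ u₀ (Φ.flow s z i).2)) := by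
  have hI : ∀ ψ : T3 → ℝ, Continuous ψ → IntervalIntegrable
      (fun s => ∑ i, ψ (Φ.flow s z i).1 * g (sv θ u₀ (Φ.flow s z i).2)) volume 0 (window τ N) := by
    intro ψ hψ
    have hF : Continuous fun w : Phase N => ∑ i, ψ (w i).1 * g (sv θ u₀ (w i).2) := by
      refine continuous_finsetSum _ fun i _ => ?_
      simp only [sv]
      fun_prop
    exact Φ.intervalIntegrable_comp_flow_of_continuous hz hF 0 _
  simp only [obsA]
  rw [← mul_sub, ← intervalIntegral.integral_sub (hI φ hφ) (hI φ' hφ'), mul_left_comm,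
    ← intervalIntegral.integral_const_mul]
  congr 1
  refine intervalIntegral.integral_congr fun s _ => ?_
  simp only [Finset.mul_sum, ← Finset.sum_sub_distrib]
  exact Finset.sum_congr rfl fun i _ => by ring

/-- **The one-site bound**: for `θ > 0`, continuous `g` with `|g| ≤ b`, `∫ g dγ = 0`, and a coefficient
`|t| ≤ |p| η`, `∫⁻ exp(t g((v - u₀)/√θ)) N(u₀, θ id)(dv) ≤ exp((|p|ηb)² e^{|p|ηb}/2)` (Hoeffding's
`exp(b²t²/2)`, `Literature.MathematicalPhysics.KineticTheory.lintegral_exp_mul_centred_gaussMeasure_le`,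
and `b²t² ≤ (|p|ηb)²`, `1 ≤ e^{|p|ηb}`). [folklore] -/
theorem lintegral_exp_oneSite_le {θ : ℝ} (hθ : 0 < θ) (u₀ : V3) {g : V3 → ℝ} (hg : Continuous g)
    {b : ℝ} (hgb : ∀ v, |g v| ≤ b) (hg0 : ∫ w, g w ∂(stdGaussian V3) = 0) {p η t : ℝ} (hη : 0 ≤ η)
    (ht : |t| ≤ |p| * η) :
    ∫⁻ v, ENNReal.ofReal (Real.exp (t * g (sv θ u₀ v))) ∂(gaussMeasure u₀ θ) ≤
      ENNReal.ofReal (Real.exp ((|p| * η * b) ^ 2 * Real.exp (|p| * η * b) / 2)) := by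
  have hb : 0 ≤ b := (abs_nonneg _).trans (hgb 0)
  have h := lintegral_exp_mul_centred_gaussMeasure_le hθ u₀ hg.measurable hgb hg0 t
  simp only [sv]
  refine h.trans (ENNReal.ofReal_le_ofReal (Real.exp_le_exp.2 ?_))
  have h1 : t ^ 2 ≤ (|p| * η) ^ 2 := by
    rw [← sq_abs t]
    exact pow_le_pow_left₀ (abs_nonneg t) ht 2
  have h2 : 1 ≤ Real.exp (|p| * η * b) := Real.one_le_exp (by positivity)
  calc b ^ 2 * t ^ 2 / 2 ≤ b ^ 2 * (|p| * η) ^ 2 / 2 := by gcongr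
    _ = (|p| * η * b) ^ 2 * 1 / 2 := by ring
    _ ≤ (|p| * η * b) ^ 2 * Real.exp (|p| * η * b) / 2 := by gcongr

/-- **Registered stub S2 `stub_lipschitzRegularisation`** of the line `dynkin-azuma-collision-innovations`
(crux stmt-AtomisticToContinuum-10967): Lipschitz regularisation of the test function is LD-free —
McShane inf-convolution on the compact torus + the STATIC window-pressure bound for the difference
functional (Jensen in time under the invariant `G_N`, Gaussian one-site factorisation, Hoeffding).
[folklore] -/
theorem stub_lipschitzRegularisation :
    ∀ (a θ : ℝ) (u₀ : V3), 0 < a → 0 < θ → ∀ σ : ℝ, 0 < σ → σ ≤ 1 / 2 →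
      ∀ (φ : T3 → ℝ) (g : V3 → ℝ) (b : ℝ), Continuous φ → Continuous g → (∀ x, |φ x| ≤ 1) →
        (∀ v, |g v| ≤ b) → ∫ v, g v ∂(stdGaussian V3) = 0 →
        ∀ η : ℝ, 0 < η →
          ∃ (φ' : T3 → ℝ) (D : ℝ), Continuous φ' ∧ (∀ x, |φ' x| ≤ 1) ∧ 0 < D ∧
            (∀ x y, |φ' x - φ' y| ≤ D * dist x y) ∧ (∀ x, |φ x - φ' x| ≤ η) ∧
            ∀ (p τ : ℝ), 0 < τ → ∀ (N : ℕ) (Φ : Flow σ N),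
              ∫⁻ z, ENNReal.ofReal (Real.exp (p * (obsA θ u₀ φ g τ Φ z - obsA θ u₀ φ' g τ Φ z)))
                  ∂(gibbs σ a θ u₀ N Φ) ≤
                ENNReal.ofReal (Real.exp ((N + 1) * ((|p| * η * b) ^ 2 * Real.exp (|p| * η * b) / 2))) := by
  intro a θ u₀ ha hθ σ _hσ hσ2 φ g b hφc hgc hφ1 hgb hg0 η hη
  obtain ⟨φ', D, hφ'c, hφ'1, hD, hLip, hclose⟩ :=
    Literature.Analysis.Approximation.exists_lipschitz_approx_of_continuous hφc hφ1 hη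
  refine ⟨φ', D, hφ'c, hφ'1, hD, hLip, hclose, ?_⟩
  intro p τ hτ N Φ
  have hw : 0 < window τ N := window_pos hτ N
  -- the one-body observable `q(x, v) = p (φ - φ')(x) g(w)`
  set q : T3 × V3 → ℝ := fun y => p * ((φ y.1 - φ' y.1) * g (sv θ u₀ y.2)) with hq
  have hqc : Continuous q := by
    simp only [hq, sv]
    fun_prop
  -- (4) the one-site bound, uniformly in the position
  have hsite : ∀ x : T3, ∫⁻ v, ENNReal.ofReal (Real.exp (q (x, v))) ∂(gaussMeasure u₀ θ) ≤
      ENNReal.ofReal (Real.exp ((|p| * η * b) ^ 2 * Real.exp (|p| * η * b) / 2)) := by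
    intro x
    have ht : |p * (φ x - φ' x)| ≤ |p| * η := by
      rw [abs_mul]
      exact mul_le_mul_of_nonneg_left (hclose x) (abs_nonneg p)
    have h := lintegral_exp_oneSite_le hθ u₀ hgc hgb hg0 hη.le ht
    have hq' : ∀ v, q (x, v) = p * (φ x - φ' x) * g (sv θ u₀ v) := fun v => by
      simp only [hq]
      ring
    simp_rw [hq']
    exact h
  -- (2)+(3) the a.e. identity and the static window-pressure bound
  have hae : ∀ᵐ z ∂(gibbs σ a θ u₀ N Φ), z ∈ Φ.good := ae_mem_good_localGibbsLaw σ _ _ _ N Φ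
  have hmain := lintegral_exp_windowAvg_sum_localGibbsLaw_const_le ha hθ u₀ hσ2 N Φ
    (measurePreserving_flow_localGibbsLaw_const σ a θ u₀ N Φ) hqc hsite hw
  calc ∫⁻ z, ENNReal.ofReal (Real.exp (p * (obsA θ u₀ φ g τ Φ z - obsA θ u₀ φ' g τ Φ z)))
          ∂(gibbs σ a θ u₀ N Φ)
      = ∫⁻ z, ENNReal.ofReal (Real.exp ((window τ N)⁻¹ * ∫ s in (0 : ℝ)..window τ N,
          ∑ i, q (Φ.flow s z i))) ∂(gibbs σ a θ u₀ N Φ) := by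
        refine lintegral_congr_ae ?_
        filter_upwards [hae] with z hz
        rw [mul_obsA_sub_obsA_eq θ u₀ hφc hφ'c hgc τ p Φ hz]
    _ ≤ ENNReal.ofReal (Real.exp ((|p| * η * b) ^ 2 * Real.exp (|p| * η * b) / 2)) ^ (N + 1) := hmain
    _ = ENNReal.ofReal (Real.exp ((N + 1) * ((|p| * η * b) ^ 2 * Real.exp (|p| * η * b) / 2))) := by
        rw [← ENNReal.ofReal_pow (Real.exp_pos _).le, ← Real.exp_nat_mul]
        push_cast
        ring_nf

end Summit.AtomisticToContinuum.HydrodynamicLimit.Theorems.DynkinAzuma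

end
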